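import Summits.QuantumFields.YangMills.Theorems.VirialFluxGapChebyshevGamma
import HarnessLib

/-!
# Route `VirialFluxGap` (YangMills): the tilted Gamma weight `β e^{−βs} s^ρ` — Chebyshev in weighted form, first / fractional moments, a floor

Third helper file toward stub `stub_tauberMeanUpper` of LINE «tauber-mean» (planner ym-idea-4 g14) on the deciding crux
`VirialFluxGap.PeriodicSoftness` (stmt-QuantumFields-24141).  With the weight `g(s) = β e^{−βs} s^ρ` on `(0,∞)` (`ρ > −1`, `β > 0`):

* `chebyshev_weighted` — the association inequality of ✓`ChebyshevGamma.integral_mul_mul_measureReal_le` rewritten for a non-negative weight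
  on a measurable set: `(∫_S w·f·h)(∫_S w) ≤ (∫_S w·f)(∫_S w·h)` (`f` monotone, `h` antitone on `S`);
* `integral_weight` : `∫ g = β Γ(ρ+1)/β^{ρ+1}`;  `integral_linear_mul_weight` : `∫ (βs − A) g = (ρ + 1 − A) ∫ g` (first moment of `Gamma(ρ+1,β)` is
  `(ρ+1)/β`);  `integral_theta_mul_weight_le` : `∫ (βs + A) s^θ g ≤ (ρ + 2 + A)·((ρ+2)/β)^θ · ∫ g` for `A ≥ 0`, `0 ≤ θ ≤ 1` (fractional
  moments via ✓`Gamma_add_le_Gamma_mul_rpow` / ✓`Gamma_add_one_add_le`);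
* `weight_floor` : `e^{−2} β^{−ρ} ≤ ∫_{(0,t₀]} g` as soon as `2/β ≤ t₀` (restrict to `[1/β, 2/β]`).

HONEST FRAMING: generic real analysis (Mathlib only); no stub / crux / rung / summit is closed by this file; the Yang–Mills mass gap is NOT proved.
THEOREMS ONLY (0 `def`, 0 `sorry`), standard axioms.  References: [cite: Griffiths1964]; [cite: TomboulisYaffe1985].
-/

set_option autoImplicit false

noncomputable section

open MeasureTheory Set Filter Real
open scoped Topology NNReal ENNReal
open Summit.QuantumFields.YangMills.Theorems.VirialFluxGap.ChebyshevGamma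

namespace Summit.QuantumFields.YangMills.Theorems.VirialFluxGap.TauberWeights

/-! ## §1 Chebyshev's inequality in weighted form -/

/-- ★ **Chebyshev's association inequality, weighted form**: `w ≥ 0` on a measurable `S`, `f` monotone and `h` antitone on `S`, with
`w`, `w f`, `w h`, `w f h` integrable on `S`: `(∫_S w f h)(∫_S w) ≤ (∫_S w f)(∫_S w h)`. [folklore] -/
theorem chebyshev_weighted {S : Set ℝ} (hS : MeasurableSet S) {w f h : ℝ → ℝ} (hw : ∀ x ∈ S, 0 ≤ w x) (hwm : Measurable w)
    (hwi : IntegrableOn w S) (hf : MonotoneOn f S) (hh : AntitoneOn h S)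
    (hfi : IntegrableOn (fun x => w x * f x) S) (hhi : IntegrableOn (fun x => w x * h x) S)
    (hfh : IntegrableOn (fun x => w x * (f x * h x)) S) :
    (∫ x in S, w x * (f x * h x)) * (∫ x in S, w x) ≤ (∫ x in S, w x * f x) * (∫ x in S, w x * h x) := by
  set μS : Measure ℝ := volume.restrict S with hμS
  set d : ℝ → ℝ≥0 := fun x => (w x).toNNReal with hd
  have hdm : Measurable d := hwm.real_toNNReal
  set ν : Measure ℝ := μS.withDensity (fun x => (d x : ℝ≥0∞)) with hν
  haveI : IsFiniteMeasure ν := by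
    rw [hν]
    refine isFiniteMeasure_withDensity_ofReal ?_
    exact hwi.2
  -- a.e. on `S`
  have haeS : ∀ᵐ x ∂μS, x ∈ S := ae_restrict_mem hS
  have hνS : ∀ᵐ x ∂ν, x ∈ S := (withDensity_absolutelyContinuous μS _).ae_le haeS
  -- `d • φ = w · φ` a.e. on `S`
  have hsmul : ∀ φ : ℝ → ℝ, (fun x => d x • φ x) =ᵐ[μS] fun x => w x * φ x := by
    intro φ
    filter_upwards [haeS] with x hx
    simp only [hd, NNReal.smul_def, smul_eq_mul, Real.coe_toNNReal _ (hw x hx)]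
  -- integrals and integrability against `ν`
  have hint : ∀ φ : ℝ → ℝ, ∫ x, φ x ∂ν = ∫ x in S, w x * φ x := by
    intro φ
    rw [hν, integral_withDensity_eq_integral_smul hdm, integral_congr_ae (hsmul φ)]
  have hintg : ∀ φ : ℝ → ℝ, IntegrableOn (fun x => w x * φ x) S → Integrable φ ν := by
    intro φ hφ
    rw [hν, integrable_withDensity_iff_integrable_smul hdm]
    exact hφ.congr (hsmul φ).symm
  have hνuniv : ν.real univ = ∫ x in S, w x := by
    have h1 := hint (fun _ => (1 : ℝ))
    simp only [integral_const, smul_eq_mul, mul_one] at h1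
    exact h1
  have h := integral_mul_mul_measureReal_le ν hνS hf hh (hintg f hfi) (hintg h hhi) (hintg _ hfh)
  rw [hint, hint, hint, hνuniv] at h
  exact h

/-! ## §2 Moments of the tilted Gamma weight `g(s) = β e^{−βs} s^ρ` -/

/-- Integrability of `s^a · (β e^{−βs} s^ρ)`-type products on `(0,∞)`: `β e^{−βs} s^a` for `a > −1`. [folklore] -/
theorem integrableOn_weight {β a : ℝ} (hβ : 0 < β) (ha : -1 < a) :
    IntegrableOn (fun s : ℝ => β * Real.exp (-(β * s)) * s ^ a) (Ioi 0) := by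
  have h : IntegrableOn (fun s : ℝ => β * (s ^ a * Real.exp (-(β * s)))) (Ioi 0) :=
    (integrableOn_rpow_mul_exp_neg_mul ha hβ).const_mul β
  refine h.congr_fun (fun s _ => ?_) measurableSet_Ioi
  ring

/-- `∫_{s>0} β e^{−βs} s^a ds = β Γ(a+1)/β^{a+1}`. [folklore] -/
theorem integral_weight {β a : ℝ} (hβ : 0 < β) (ha : -1 < a) :
    ∫ s in Ioi (0 : ℝ), β * Real.exp (-(β * s)) * s ^ a = β * (Real.Gamma (a + 1) / β ^ (a + 1)) := by
  rw [← integral_rpow_mul_exp_neg_mul_Ioi' ha hβ, ← integral_const_mul]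
  refine setIntegral_congr_fun measurableSet_Ioi (fun s _ => ?_)
  ring

/-- The weight has positive mass: `0 < ∫ g`. [folklore] -/
theorem integral_weight_pos {β ρ : ℝ} (hβ : 0 < β) (hρ : -1 < ρ) :
    0 < ∫ s in Ioi (0 : ℝ), β * Real.exp (-(β * s)) * s ^ ρ := by
  rw [integral_weight hβ hρ]
  exact mul_pos hβ (div_pos (Real.Gamma_pos_of_pos (by linarith)) (Real.rpow_pos_of_pos hβ _))

/-- ★ **First moment**: `∫ (βs − A)·g = (ρ + 1 − A)·∫ g` (the mean of `Gamma(ρ+1, β)` is `(ρ+1)/β`). [folklore] -/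
theorem integral_linear_mul_weight {β ρ : ℝ} (hβ : 0 < β) (hρ : -1 < ρ) (A : ℝ) :
    ∫ s in Ioi (0 : ℝ), (β * s - A) * (β * Real.exp (-(β * s)) * s ^ ρ) =
      (ρ + 1 - A) * ∫ s in Ioi (0 : ℝ), β * Real.exp (-(β * s)) * s ^ ρ := by
  have hρ1 : -1 < ρ + 1 := by linarith
  have h1 := integrableOn_weight hβ hρ1
  have h0 := integrableOn_weight hβ hρ
  -- pointwise: `(βs − A) g = β · (β e^{−βs} s^{ρ+1}) − A · g` on `(0,∞)`
  have hpt : ∀ s ∈ Ioi (0 : ℝ), (β * s - A) * (β * Real.exp (-(β * s)) * s ^ ρ) =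
      β * (β * Real.exp (-(β * s)) * s ^ (ρ + 1)) - A * (β * Real.exp (-(β * s)) * s ^ ρ) := by
    intro s hs
    rw [Real.rpow_add hs, Real.rpow_one]; ring
  rw [setIntegral_congr_fun measurableSet_Ioi hpt, integral_sub (h1.const_mul β) (h0.const_mul A), integral_const_mul,
    integral_const_mul, integral_weight hβ hρ1, integral_weight hβ hρ]
  rw [show ρ + 1 + 1 = (ρ + 1) + 1 by ring, Real.Gamma_add_one (by linarith : ρ + 1 ≠ 0), Real.rpow_add hβ _ 1, Real.rpow_one]
  have hβρ : 0 < β ^ (ρ + 1) := Real.rpow_pos_of_pos hβ _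
  field_simp

/-- ★ **Fractional moments**: for `A ≥ 0`, `0 ≤ θ ≤ 1`: `∫ (βs + A) s^θ g ≤ (ρ + 2 + A)·((ρ+2)/β)^θ·∫ g`. [folklore] -/
theorem integral_theta_mul_weight_le {β ρ θ A : ℝ} (hβ : 0 < β) (hρ : 0 < ρ + 1) (hθ0 : 0 ≤ θ) (hθ1 : θ ≤ 1) (hA : 0 ≤ A) :
    ∫ s in Ioi (0 : ℝ), (β * s + A) * s ^ θ * (β * Real.exp (-(β * s)) * s ^ ρ) ≤
      (ρ + 2 + A) * ((ρ + 2) / β) ^ θ * ∫ s in Ioi (0 : ℝ), β * Real.exp (-(β * s)) * s ^ ρ := by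
  have hρ' : -1 < ρ := by linarith
  have hρθ : -1 < ρ + θ := by linarith
  have hρ1θ : -1 < ρ + 1 + θ := by linarith
  have hIθ := integrableOn_weight hβ hρθ
  have hI1θ := integrableOn_weight hβ hρ1θ
  have hpt : ∀ s ∈ Ioi (0 : ℝ), (β * s + A) * s ^ θ * (β * Real.exp (-(β * s)) * s ^ ρ) =
      β * (β * Real.exp (-(β * s)) * s ^ (ρ + 1 + θ)) + A * (β * Real.exp (-(β * s)) * s ^ (ρ + θ)) := by
    intro s hs
    have hs' : (0 : ℝ) < s := hs
    rw [Real.rpow_add hs' (ρ + 1) θ, Real.rpow_add hs' ρ 1, Real.rpow_add hs' ρ θ, Real.rpow_one]; ring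
  rw [setIntegral_congr_fun measurableSet_Ioi hpt, integral_add (hI1θ.const_mul β) (hIθ.const_mul A), integral_const_mul,
    integral_const_mul, integral_weight hβ hρ1θ, integral_weight hβ hρθ, integral_weight hβ hρ']
  -- Gamma bounds
  have hΓ0 : 0 < Real.Gamma (ρ + 1) := Real.Gamma_pos_of_pos hρ
  have hG1 : Real.Gamma (ρ + 1 + θ + 1) ≤ Real.Gamma (ρ + 1) * (ρ + 2) ^ (1 + θ) := by
    have h := Gamma_add_one_add_le (x := ρ + 1) hρ hθ0 hθ1
    rw [show ρ + 1 + 1 + θ = ρ + 1 + θ + 1 by ring, show ρ + 1 + 1 = ρ + 2 by ring] at h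
    exact h
  have hG2 : Real.Gamma (ρ + θ + 1) ≤ Real.Gamma (ρ + 1) * (ρ + 2) ^ θ := by
    have h := Gamma_add_le_Gamma_mul_rpow (x := ρ + 1) hρ hθ0 hθ1
    rw [show ρ + 1 + θ = ρ + θ + 1 by ring] at h
    refine h.trans (mul_le_mul_of_nonneg_left ?_ hΓ0.le)
    exact Real.rpow_le_rpow (by linarith) (by linarith) hθ0
  -- powers of β
  have hb1 : β ^ (ρ + 1 + θ + 1) = β ^ (ρ + 1) * β ^ (1 + θ) := by
    rw [← Real.rpow_add hβ]; congr 1; ring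
  have hb2 : β ^ (ρ + θ + 1) = β ^ (ρ + 1) * β ^ θ := by
    rw [← Real.rpow_add hβ]; congr 1; ring
  have hu : ((ρ + 2) / β) ^ θ = (ρ + 2) ^ θ / β ^ θ := Real.div_rpow (by linarith) hβ.le θ
  have hu1 : (ρ + 2) ^ (1 + θ) = (ρ + 2) * (ρ + 2) ^ θ := by
    rw [Real.rpow_add (by linarith : (0:ℝ) < ρ + 2), Real.rpow_one]
  rw [hb1, hb2, hu]
  have hβρ : 0 < β ^ (ρ + 1) := Real.rpow_pos_of_pos hβ _
  have hβθ : 0 < β ^ θ := Real.rpow_pos_of_pos hβ _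
  have hβ1θ : β ^ (1 + θ) = β * β ^ θ := by rw [Real.rpow_add hβ, Real.rpow_one]
  rw [hβ1θ]
  have hρ2θ : 0 ≤ (ρ + 2) ^ θ := Real.rpow_nonneg (by linarith) _
  -- compare term by term
  have t1 : β * (β * (Real.Gamma (ρ + 1 + θ + 1) / (β ^ (ρ + 1) * (β * β ^ θ)))) ≤
      (ρ + 2) * ((ρ + 2) ^ θ / β ^ θ) * (β * (Real.Gamma (ρ + 1) / β ^ (ρ + 1))) := by
    have e1 : β * (β * (Real.Gamma (ρ + 1 + θ + 1) / (β ^ (ρ + 1) * (β * β ^ θ)))) =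
        β * Real.Gamma (ρ + 1 + θ + 1) / (β ^ (ρ + 1) * β ^ θ) := by field_simp
    have e2 : (ρ + 2) * ((ρ + 2) ^ θ / β ^ θ) * (β * (Real.Gamma (ρ + 1) / β ^ (ρ + 1))) =
        β * (Real.Gamma (ρ + 1) * ((ρ + 2) * (ρ + 2) ^ θ)) / (β ^ (ρ + 1) * β ^ θ) := by field_simp
    rw [e1, e2, ← hu1]
    exact div_le_div_of_nonneg_right (mul_le_mul_of_nonneg_left hG1 hβ.le) (by positivity)
  have t2 : A * (β * (Real.Gamma (ρ + θ + 1) / (β ^ (ρ + 1) * β ^ θ))) ≤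
      A * ((ρ + 2) ^ θ / β ^ θ) * (β * (Real.Gamma (ρ + 1) / β ^ (ρ + 1))) := by
    have e2 : A * ((ρ + 2) ^ θ / β ^ θ) * (β * (Real.Gamma (ρ + 1) / β ^ (ρ + 1))) =
        A * (β * (Real.Gamma (ρ + 1) * (ρ + 2) ^ θ / (β ^ (ρ + 1) * β ^ θ))) := by field_simp
    rw [e2]
    refine mul_le_mul_of_nonneg_left (mul_le_mul_of_nonneg_left ?_ hβ.le) hA
    exact div_le_div_of_nonneg_right hG2 (by positivity)
  calc β * (β * (Real.Gamma (ρ + 1 + θ + 1) / (β ^ (ρ + 1) * (β * β ^ θ)))) +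
        A * (β * (Real.Gamma (ρ + θ + 1) / (β ^ (ρ + 1) * β ^ θ)))
      ≤ (ρ + 2) * ((ρ + 2) ^ θ / β ^ θ) * (β * (Real.Gamma (ρ + 1) / β ^ (ρ + 1))) +
        A * ((ρ + 2) ^ θ / β ^ θ) * (β * (Real.Gamma (ρ + 1) / β ^ (ρ + 1))) := add_le_add t1 t2
    _ = (ρ + 2 + A) * ((ρ + 2) ^ θ / β ^ θ) * (β * (Real.Gamma (ρ + 1) / β ^ (ρ + 1))) := by ring

/-! ## §3 A floor for the weight on `(0, t₀]` -/

/-- ★ `e^{−2} β^{−ρ} ≤ ∫_{(0,t₀]} β e^{−βs} s^ρ ds` when `2/β ≤ t₀`, `ρ ≥ 0` (restrict to `[1/β, 2/β]`). [folklore] -/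
theorem weight_floor {β ρ t₀ : ℝ} (hβ : 0 < β) (hρ : 0 ≤ ρ) (ht₀ : 2 / β ≤ t₀) :
    Real.exp (-2) * β ^ (-ρ) ≤ ∫ s in Ioc (0 : ℝ) t₀, β * Real.exp (-(β * s)) * s ^ ρ := by
  have hρ' : -1 < ρ := by linarith
  have hsub : Icc (1 / β) (2 / β) ⊆ Ioc (0 : ℝ) t₀ := fun s hs =>
    ⟨lt_of_lt_of_le (by positivity) hs.1, hs.2.trans ht₀⟩
  have hint : IntegrableOn (fun s : ℝ => β * Real.exp (-(β * s)) * s ^ ρ) (Ioc 0 t₀) :=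
    (integrableOn_weight hβ hρ').mono_set Ioc_subset_Ioi_self
  have hnn : 0 ≤ᵐ[volume.restrict (Ioc (0 : ℝ) t₀)] fun s => β * Real.exp (-(β * s)) * s ^ ρ := by
    filter_upwards [ae_restrict_mem measurableSet_Ioc] with s hs
    have : 0 ≤ s ^ ρ := Real.rpow_nonneg hs.1.le _
    positivity
  -- lower bound on the sub-interval
  have hlow : ∀ s ∈ Icc (1 / β) (2 / β), β * (Real.exp (-2) * (1 / β) ^ ρ) ≤ β * Real.exp (-(β * s)) * s ^ ρ := by
    intro s hs
    have hs0 : 0 < s := lt_of_lt_of_le (by positivity) hs.1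
    have h1 : Real.exp (-2) ≤ Real.exp (-(β * s)) := by
      refine Real.exp_le_exp.2 ?_
      have : β * s ≤ 2 := by
        have := hs.2; rwa [le_div_iff₀ hβ, mul_comm] at this
      linarith
    have h2 : (1 / β) ^ ρ ≤ s ^ ρ := Real.rpow_le_rpow (by positivity) hs.1 hρ
    have h3 : 0 ≤ (1 / β) ^ ρ := Real.rpow_nonneg (by positivity) _
    calc β * (Real.exp (-2) * (1 / β) ^ ρ) ≤ β * (Real.exp (-(β * s)) * s ^ ρ) := by
          refine mul_le_mul_of_nonneg_left ?_ hβ.le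
          exact mul_le_mul h1 h2 h3 (Real.exp_pos _).le
      _ = β * Real.exp (-(β * s)) * s ^ ρ := by ring
  have h12 : (0 : ℝ) ≤ 2 / β - 1 / β := by
    rw [sub_nonneg]; exact div_le_div_of_nonneg_right (by norm_num) hβ.le
  calc Real.exp (-2) * β ^ (-ρ)
      = (volume.real (Icc (1 / β) (2 / β))) • (β * (Real.exp (-2) * (1 / β) ^ ρ)) := by
        rw [measureReal_def, Real.volume_Icc, ENNReal.toReal_ofReal h12, smul_eq_mul,
          one_div, Real.inv_rpow hβ.le, Real.rpow_neg hβ.le]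
        have hβρ : 0 < β ^ ρ := Real.rpow_pos_of_pos hβ _
        field_simp
        ring
    _ ≤ ∫ s in Icc (1 / β) (2 / β), β * Real.exp (-(β * s)) * s ^ ρ :=
        setIntegral_ge_of_const_le (μ := volume) (s := Icc (1 / β) (2 / β)) measurableSet_Icc
          (by rw [Real.volume_Icc]; exact ENNReal.ofReal_ne_top) hlow (hint.mono_set hsub).integrable
    _ ≤ ∫ s in Ioc (0 : ℝ) t₀, β * Real.exp (-(β * s)) * s ^ ρ :=
        setIntegral_mono_set hint hnn (Eventually.of_forall hsub)

end Summit.QuantumFields.YangMills.Theorems.VirialFluxGap.TauberWeights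

end
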